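import Summits.RiemannHypothesis.RiemannHypothesis.Theses.WeilComb
import Summits.RiemannHypothesis.RiemannHypothesis.Theorems.WeilCombCombSubcriticalStubAutocorrelation
import Summits.RiemannHypothesis.RiemannHypothesis.Theorems.WeilCombCombSubcriticalStubPolar
import Summits.RiemannHypothesis.RiemannHypothesis.Theorems.WeilCombCombSubcriticalStubPrime
import Summits.RiemannHypothesis.RiemannHypothesis.Theorems.WeilCombCombSubcriticalStubArch
import Summits.RiemannHypothesis.RiemannHypothesis.Theorems.CombSubcritical.Negative.WeilCombCombSubcriticalLoadBearing
import Summits.RiemannHypothesis.RiemannHypothesis.Theorems.CombSubcritical.Negative.WeilCombCombSubcriticalSmallModels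
import Literature.NumberTheory.LFunctions.WeilExplicit
import Literature.NumberTheory.LFunctions.WeilArchimedeanMoments
import Literature.NumberTheory.LFunctions.WeilGroundEnergyProofs
import Literature.NumberTheory.LFunctions.RosserSchoenfeldVonMangoldtSum
import Literature.NumberTheory.LFunctions.MontgomeryOffDiagonalTools
import HarnessLib.Audit

/-!
# Line `tilted-gauge-hardy` — skeleton for crux `WeilComb.CombSubcritical` ("Theorem A")
(item stmt-RiemannHypothesis-1025, route route-RiemannHypothesis-WeilComb; crux idea card
`Cruxes/CombSubcritical/Ideas/tilted-gauge-hardy.md`, triage r1-2 / r1-3: pass)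

**Idea.** Bound the von Mangoldt Helson form `⟨S_M a,a⟩ = 2 Re Σ_{nm ≤ M} Λ(n) n^{-1/2} a_{nm} ā_m`
(the prime side of the comb matrix; literally the left side of the route's `CombHelsonBound`)
EDGE BY EDGE with AM–GM in the TILTED Perron gauge `θ_{n,m} = √n · (1 − β·nm/M)` — an edge
1-form on the divisor graph which is not the coboundary of any vertex weight.  The upper vertex
`k = nm` then pays `(1 − βk/M) Σ_{n ∣ k} Λ(n) = (1 − βk/M) log k`, the lower vertex pays
`Σ_{n ≤ M/k} (Λ(n)/n)(1 − βnk/M)⁻¹ ≤ ψ₁(M/k) + (β/(1−β))(k/M)ψ(M/k) ≤ log(M/k) + 1 + C_ψ β/(1−β)`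
(Mertens, Chebyshev), so for every `β ∈ [0,1)`

  `⟨S_M a,a⟩ + (β/M) Σ_k k log k ‖a_k‖² ≤ (log M + 1 + C_ψ β/(1−β)) ‖a‖²`      (`stub_hardy`)

— the Helson bound `log M + O(1)` TOGETHER with a Hardy-type penalty on top-heavy mass.  That penalty
is exactly the currency in which the archimedean shadow of the comb (absolute log-Hilbert row sums,
the rank-2 polar term, `‖a‖₁²`) is charged: `archShadow(a) ≤ K₁ Σ k log k ‖a_k‖² + K₂ M ‖a‖²`
(`stub_shadow`).  With `β = K₁ c₀ ≤ 1/2` the two give the arithmetic core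
`∀ C ∃ c₀ ≤ 1/8 ∀ M ≥ 1 ∀ a, ⟨S_M a,a⟩ + (c₀/M)·archShadow(a) ≤ (log M + log(1/c₀) − C)‖a‖²`
in three lines (`core_of_hardy_shadow`, PROVED below), and the analytic half of the crux — the exact
Weil form `W = polar − prime + arch` on the comb autocorrelation — is IMPORTED from the tree
(landed theorems `stub_autocorrelation`, `stub_polar`, `stub_prime`, `stub_arch` of namespace
`…Theorems.WeilCombSubcritical`, proved for the picked line `helson-dirichlet-slack`), assembled here
into `analyticReduction` and glued into `CombSubcritical_of`, which concludes the crux BY NAME.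

Registered stubs (sorries live only here): `stub_hardy` (the lever, hardest), `stub_shadow`.
Everything else in this file is sorry-free glue.  The composition `analyticReduction` /
`CombSubcritical_of` re-uses, nearly verbatim and with credit, the glue of the lead's rev-L2 skeleton
`Lines/helson-dirichlet-slack.lean` (only the arithmetic core is swapped).

Dictionary (verbatim expansions, no local `def`, so that every stub lands as a pure proof):
* `H`  = `helsonForm M a` ↦ `2 * (∑ m ∈ Icc 1 M, ∑ n ∈ Icc 1 (M / m), Λ(n)/√n · a (n m) · conj (a m)).re`
* `L`  = `l2 M a`         ↦ `∑ m ∈ Icc 1 M, ‖a m‖²`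
* `T`  = top mass         ↦ `∑ k ∈ Icc 1 M, k · log k · ‖a k‖²`   (the card's `topMass = T / M`)
* `Sh` = `archShadow M a` ↦ `5 A₋ A₊ + 2 B_abs + 2 (∑ ‖a m‖)²`, `A₋ = ∑ ‖a m‖/√m`, `A₊ = ∑ ‖a m‖ √m`,
  `B_abs = ∑_m ∑_{m' ≠ m} ‖a m‖ ‖a m'‖ / |log m − log m'|`
* `comb φ ε M a` ↦ `fun x ↦ ∑ m ∈ Icc 1 M, a m * ((ε:ℂ)⁻¹ * φ ((x − log m)/ε))` (the crux's function).

Disproof.lean (cdisprove v3) honoured: no `_false_without_` theorem exists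
(`combSubcritical_of_riemannHypothesis`: no kill short of ¬RH); the two load-bearing hypotheses
(landed Negative lemmas `weilComb_combSubcritical_withoutWindow_iff_riemannHypothesis`,
`weilComb_combSubcritical_withoutSupport_iff_riemannHypothesis`, imported above as a scratch check)
are consumed visibly: the window `ε·M ≤ c₀` three times in `CombSubcritical_of` (`8εM ≤ 1` for the
exact prime term, `ε ≤ c₀/M` to pay the shadow, `log(1/ε) ≥ log M + log(1/c₀)` as the budget against
which `stub_hardy`'s `log M + 1 + O(1)` is compared), the support `tsupport φ ⊆ [-1,1]` inside the
imported `stub_prime` / `stub_arch` / `stub_polar`; `M ≤ 1` agrees with `weilComb_combSubcritical_upto_one`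
(`M = 1`: `S_1 = 0`, `stub_hardy` reads `0 ≤ (1 + Cβ/(1−β))‖a‖²`).  Neither stub is an instance of the
crux, of `CombShapePositivity`, of `WeilPositivity` or of the summit (both are prime-side /
finite-dimensional inequalities with no `W` in them).
-/

noncomputable section

open scoped BigOperators ComplexConjugate
open Complex MeasureTheory Set

namespace Summit.RiemannHypothesis.RiemannHypothesis.Cruxes.CombSubcritical.TiltedGaugeHardy

open Literature.NumberTheory.LFunctions
open Summit.RiemannHypothesis.RiemannHypothesis.Theorems
open Summit.RiemannHypothesis.RiemannHypothesis.Theorems.WeilCombSubcritical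

/-! ### The registered stubs (signatures over existing declarations only) -/

/-- **Stub 1 — `HelsonHardy` (the lever; LOAD-BEARING, hardest).**  There is an absolute `C` such
that for every tilt `β ∈ [0,1)`, every `M ≥ 1` and every `a`,
`⟨S_M a,a⟩ + (β/M)·Σ_{k ≤ M} k log k ‖a_k‖² ≤ (log M + 1 + C β/(1−β)) ‖a‖²`.
Proof (paper, complete): per edge `(m, n)`, `nm ≤ M`, AM–GM
`2 Re(Λ(n) n^{-1/2} a_{nm} ā_m) ≤ Λ(n) n^{-1/2} (θ ‖a_{nm}‖² + θ⁻¹ ‖a_m‖²)` with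
`θ = √n (1 − β nm/M) ∈ (0, √n]`; collect `‖a_k‖²`: edges ENDING at `k` (reindex `nm = k` over
`Nat.divisorsAntidiagonal k`, as in the landed `stub_identity`) give `(1 − βk/M) Σ_{n∣k} Λ(n) =
(1 − βk/M) log k` (`ArithmeticFunction.vonMangoldt_sum`); edges STARTING at `k` give
`Σ_{n ≤ M/k} (Λ(n)/n)(1 − βnk/M)⁻¹ ≤ Σ_{n ≤ M/k} (Λ(n)/n)(1 + (β/(1−β)) nk/M)
= ψ₁(⌊M/k⌋) + (β/(1−β))(k/M) ψ(⌊M/k⌋) ≤ (log(M/k) + 1) + (β/(1−β))(log 4 + 4)`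
(`sum_vonMangoldt_div_lt_log_add_one` with `⌊(M:ℝ)/k⌋₊ = M/k`, `sum_Icc_vonMangoldt_le`); the
coefficient of `‖a_k‖²` is therefore `≤ log M + 1 + (log 4 + 4) β/(1−β) − β (k/M) log k`.
So `C = log 4 + 4` works (numerically the true constant at `β = 0.9` is `0.55` vs the paper's `10.4`;
kit j010689 part D, triage r1-2/r1-3).  `β = 0` is `CombHelsonBound`; `β → 1` blows up honestly
(a prime `k = p ∈ (M/2, M]` has coefficient `(1−β) log p`). -/
theorem stub_hardy :
    ∃ C : ℝ, ∀ β : ℝ, 0 ≤ β → β < 1 → ∀ (M : ℕ) (a : ℕ → ℂ), 1 ≤ M →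
      2 * (∑ m ∈ Finset.Icc 1 M, ∑ n ∈ Finset.Icc 1 (M / m),
          ((ArithmeticFunction.vonMangoldt n : ℝ) : ℂ) / (Real.sqrt n : ℂ) * a (n * m) *
            conj (a m)).re +
        β / M * ∑ k ∈ Finset.Icc 1 M, (k : ℝ) * Real.log k * ‖a k‖ ^ 2 ≤
      (Real.log M + 1 + C * β / (1 - β)) * ∑ m ∈ Finset.Icc 1 M, ‖a m‖ ^ 2 := by
  sorry

/-- **Stub 2 — `ShadowTopHeavy` (the archimedean shadow is charged in top-heavy currency).**
There are absolute `K₁, K₂` with, for all `M ≥ 1` and all `a`,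
`5 A₋ A₊ + 2 B_abs + 2 (Σ ‖a_m‖)² ≤ K₁ Σ_{k ≤ M} k log k ‖a_k‖² + K₂ M ‖a‖²`.
Proof (paper): (i) `(Σ_{m ≤ M} ‖a_m‖)² ≤ M ‖a‖²` (Cauchy–Schwarz).  (ii) Schur/AM–GM on the symmetric
kernel: `B_abs ≤ Σ_m R_m ‖a_m‖²`, `R_m = Σ_{m' ≠ m, m' ≤ M} 1/|log m − log m'|`; from
`log x − log y ≥ (x − y)/x` one has `1/|log m − log m'| ≤ m/|m − m'| + 1`, so
`R_m ≤ 2m(1 + log M) + M ≤ 2 m log m + 4M` (`2m log(M/m) ≤ (2/e) M`); hence `2 B_abs ≤ 4T + 8 M‖a‖²`.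
(iii) Cauchy–Schwarz twice: `A₋² ≤ ‖a‖² Σ_{m ≤ M} 1/m ≤ ‖a‖² (1 + log M)`,
`A₊² ≤ X · Σ_{m ≤ M} 1/(1 + log m)` with `X = Σ m (1 + log m) ‖a_m‖² = T + Σ m ‖a_m‖² ≤ T + M‖a‖²`, and
`(1 + log M) Σ_{m ≤ M} 1/(1 + log m) ≤ 4M` (via `(1 + log M)/(1 + log m) ≤ 2√(M/m)`, `Σ 1/√m ≤ 2√M`);
so `A₋ A₊ ≤ 2 √(M‖a‖² · X) ≤ M‖a‖² + X ≤ T + 2M‖a‖²`.  Total: `K₁ = 9`, `K₂ = 20` work.  (Each piece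
has a private template in the landed `Theorems/WeilCombCombSubcriticalStubCore.lean`:
`inv_abs_log_sub_le`, `sum_one_div_le_log`, `one_add_log_mul_sum_le`, `sum_Icc_inv_sqrt_le`.)
Row-sum numerics: `max_m R_m/(3m(1 + log m) + 2M) ≤ 0.52` for `M ≤ 1500` (triage r1-2 part B). -/
theorem stub_shadow :
    ∃ K₁ K₂ : ℝ, ∀ (M : ℕ) (a : ℕ → ℂ), 1 ≤ M →
      5 * (∑ m ∈ Finset.Icc 1 M, ‖a m‖ / Real.sqrt m) *
            (∑ m ∈ Finset.Icc 1 M, ‖a m‖ * Real.sqrt m) +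
          2 * (∑ m ∈ Finset.Icc 1 M, ∑ m' ∈ (Finset.Icc 1 M).erase m,
            ‖a m‖ * ‖a m'‖ / |Real.log m - Real.log m'|) +
          2 * (∑ m ∈ Finset.Icc 1 M, ‖a m‖) ^ 2 ≤
        K₁ * ∑ k ∈ Finset.Icc 1 M, (k : ℝ) * Real.log k * ‖a k‖ ^ 2 +
          K₂ * M * ∑ m ∈ Finset.Icc 1 M, ‖a m‖ ^ 2 := by
  sorry

/-! ### The composition (sorry-free glue; concludes the crux BY NAME) -/

/-- **The arithmetic core from the two stubs** (the card's "TopHeavyCore in three lines", in the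
currency of the landed analytic reduction).  Given `HelsonHardy` with constant `C_H` and
`ShadowTopHeavy` with constants `K₁, K₂` (WLOG all `≥ 0`): for every `C` put
`E = C + 1 + C_H + K₂`, `c₀ = min(1/8, 1/(2(K₁+1)), e^{−E})`, `β = K₁ c₀ ≤ 1/2`; then for `M ≥ 1`
`H + (c₀/M) Sh ≤ H + (β/M) T + c₀ K₂ L ≤ (log M + 1 + C_H β/(1−β) + K₂) L ≤ (log M + 1 + C_H + K₂) L
≤ (log M + log(1/c₀) − C) L`, because `β/(1−β) ≤ 1` and `log(1/c₀) ≥ E`. -/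
theorem core_of_hardy_shadow
    (hH : ∃ C : ℝ, ∀ β : ℝ, 0 ≤ β → β < 1 → ∀ (M : ℕ) (a : ℕ → ℂ), 1 ≤ M →
      2 * (∑ m ∈ Finset.Icc 1 M, ∑ n ∈ Finset.Icc 1 (M / m),
          ((ArithmeticFunction.vonMangoldt n : ℝ) : ℂ) / (Real.sqrt n : ℂ) * a (n * m) *
            conj (a m)).re +
        β / M * ∑ k ∈ Finset.Icc 1 M, (k : ℝ) * Real.log k * ‖a k‖ ^ 2 ≤
      (Real.log M + 1 + C * β / (1 - β)) * ∑ m ∈ Finset.Icc 1 M, ‖a m‖ ^ 2)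
    (hS : ∃ K₁ K₂ : ℝ, ∀ (M : ℕ) (a : ℕ → ℂ), 1 ≤ M →
      5 * (∑ m ∈ Finset.Icc 1 M, ‖a m‖ / Real.sqrt m) *
            (∑ m ∈ Finset.Icc 1 M, ‖a m‖ * Real.sqrt m) +
          2 * (∑ m ∈ Finset.Icc 1 M, ∑ m' ∈ (Finset.Icc 1 M).erase m,
            ‖a m‖ * ‖a m'‖ / |Real.log m - Real.log m'|) +
          2 * (∑ m ∈ Finset.Icc 1 M, ‖a m‖) ^ 2 ≤
        K₁ * ∑ k ∈ Finset.Icc 1 M, (k : ℝ) * Real.log k * ‖a k‖ ^ 2 +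
          K₂ * M * ∑ m ∈ Finset.Icc 1 M, ‖a m‖ ^ 2) :
    ∀ C : ℝ, ∃ c₀ : ℝ, 0 < c₀ ∧ c₀ ≤ 1 / 8 ∧ ∀ (M : ℕ) (a : ℕ → ℂ), 1 ≤ M →
      2 * (∑ m ∈ Finset.Icc 1 M, ∑ n ∈ Finset.Icc 1 (M / m),
          ((ArithmeticFunction.vonMangoldt n : ℝ) : ℂ) / (Real.sqrt n : ℂ) * a (n * m) *
            conj (a m)).re +
        c₀ / M * (5 * (∑ m ∈ Finset.Icc 1 M, ‖a m‖ / Real.sqrt m) *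
              (∑ m ∈ Finset.Icc 1 M, ‖a m‖ * Real.sqrt m) +
            2 * (∑ m ∈ Finset.Icc 1 M, ∑ m' ∈ (Finset.Icc 1 M).erase m,
              ‖a m‖ * ‖a m'‖ / |Real.log m - Real.log m'|) +
            2 * (∑ m ∈ Finset.Icc 1 M, ‖a m‖) ^ 2) ≤
      (Real.log M + Real.log (1 / c₀) - C) * ∑ m ∈ Finset.Icc 1 M, ‖a m‖ ^ 2 := by
  obtain ⟨CH, hCH⟩ := hH
  obtain ⟨K₁, K₂, hK⟩ := hS
  intro C
  -- nonnegative majorants of the three constants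
  have hCH'0 : (0 : ℝ) ≤ max CH 0 := le_max_right _ _
  have hK₁'0 : (0 : ℝ) ≤ max K₁ 0 := le_max_right _ _
  have hK₂'0 : (0 : ℝ) ≤ max K₂ 0 := le_max_right _ _
  -- the window constant
  refine ⟨min (1 / 8) (min (1 / (2 * (max K₁ 0 + 1))) (Real.exp (-(C + 1 + max CH 0 + max K₂ 0)))),
    ?_, min_le_left _ _, ?_⟩
  · refine lt_min (by norm_num) (lt_min ?_ (Real.exp_pos _))
    positivity
  set c₀ : ℝ := min (1 / 8) (min (1 / (2 * (max K₁ 0 + 1)))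
    (Real.exp (-(C + 1 + max CH 0 + max K₂ 0)))) with hc₀def
  have hc₀pos : 0 < c₀ := by
    refine lt_min (by norm_num) (lt_min ?_ (Real.exp_pos _))
    positivity
  have hc₀8 : c₀ ≤ 1 / 8 := min_le_left _ _
  have hc₀K : c₀ ≤ 1 / (2 * (max K₁ 0 + 1)) := (min_le_right _ _).trans (min_le_left _ _)
  have hc₀E : c₀ ≤ Real.exp (-(C + 1 + max CH 0 + max K₂ 0)) :=
    (min_le_right _ _).trans (min_le_right _ _)
  have hc₀1 : c₀ ≤ 1 := hc₀8.trans (by norm_num)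
  -- the budget `log(1/c₀) ≥ E`
  have hlogc : C + 1 + max CH 0 + max K₂ 0 ≤ Real.log (1 / c₀) := by
    have h := Real.log_le_log hc₀pos hc₀E
    rw [Real.log_exp] at h
    rw [one_div, Real.log_inv]
    linarith
  -- the tilt `β = K₁' c₀ ∈ [0, 1/2]`
  set β : ℝ := max K₁ 0 * c₀ with hβdef
  have hβ0 : 0 ≤ β := mul_nonneg hK₁'0 hc₀pos.le
  have hβhalf : β ≤ 1 / 2 := by
    have h1 : max K₁ 0 * c₀ ≤ max K₁ 0 * (1 / (2 * (max K₁ 0 + 1))) :=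
      mul_le_mul_of_nonneg_left hc₀K hK₁'0
    have h2 : max K₁ 0 * (1 / (2 * (max K₁ 0 + 1))) ≤ 1 / 2 := by
      rw [mul_one_div, div_le_div_iff₀ (by positivity) (by norm_num : (0 : ℝ) < 2)]
      nlinarith
    linarith
  have hβ1 : β < 1 := by linarith
  have h1β : 0 < 1 - β := by linarith
  intro M a hM
  have hMr : (1 : ℝ) ≤ (M : ℝ) := by exact_mod_cast hM
  have hMpos : (0 : ℝ) < (M : ℝ) := by linarith
  -- the two stubs at this `M`, `a` (and `β`)
  have hHM := hCH β hβ0 hβ1 M a hM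
  have hSM := hK M a hM
  -- names for the real atoms
  set H : ℝ := 2 * (∑ m ∈ Finset.Icc 1 M, ∑ n ∈ Finset.Icc 1 (M / m),
      ((ArithmeticFunction.vonMangoldt n : ℝ) : ℂ) / (Real.sqrt n : ℂ) * a (n * m) *
        conj (a m)).re with hHdef
  set L : ℝ := ∑ m ∈ Finset.Icc 1 M, ‖a m‖ ^ 2 with hLdef
  set T : ℝ := ∑ k ∈ Finset.Icc 1 M, (k : ℝ) * Real.log k * ‖a k‖ ^ 2 with hTdef
  set Sh : ℝ := 5 * (∑ m ∈ Finset.Icc 1 M, ‖a m‖ / Real.sqrt m) *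
        (∑ m ∈ Finset.Icc 1 M, ‖a m‖ * Real.sqrt m) +
      2 * (∑ m ∈ Finset.Icc 1 M, ∑ m' ∈ (Finset.Icc 1 M).erase m,
        ‖a m‖ * ‖a m'‖ / |Real.log m - Real.log m'|) +
      2 * (∑ m ∈ Finset.Icc 1 M, ‖a m‖) ^ 2 with hShdef
  have hL0 : 0 ≤ L := Finset.sum_nonneg fun _ _ => by positivity
  have hT0 : 0 ≤ T := by
    refine Finset.sum_nonneg fun k hk => ?_
    have hk1 : (1 : ℝ) ≤ (k : ℝ) := by exact_mod_cast (Finset.mem_Icc.mp hk).1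
    have hlogk : 0 ≤ Real.log (k : ℝ) := Real.log_nonneg hk1
    positivity
  -- (1) the shadow with nonnegative constants, times `c₀/M`
  have hS1 : Sh ≤ max K₁ 0 * T + max K₂ 0 * M * L := by
    have h1 : K₁ * T ≤ max K₁ 0 * T := mul_le_mul_of_nonneg_right (le_max_left _ _) hT0
    have h2 : K₂ * (M * L) ≤ max K₂ 0 * (M * L) :=
      mul_le_mul_of_nonneg_right (le_max_left _ _) (mul_nonneg hMpos.le hL0)
    have h2' : K₂ * M * L ≤ max K₂ 0 * M * L := by
      simpa only [mul_assoc] using h2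
    linarith
  have hcM : 0 ≤ c₀ / M := div_nonneg hc₀pos.le hMpos.le
  have hA1 : c₀ / M * Sh ≤ β / M * T + c₀ * max K₂ 0 * L := by
    have h := mul_le_mul_of_nonneg_left hS1 hcM
    have e : c₀ / M * (max K₁ 0 * T + max K₂ 0 * M * L) = β / M * T + c₀ * max K₂ 0 * L := by
      rw [hβdef]
      field_simp
    linarith [h, e.le, e.ge]
  -- (2) `C_H β/(1−β) ≤ C_H'` since `0 ≤ β/(1−β) ≤ 1`
  have hfrac0 : 0 ≤ β / (1 - β) := div_nonneg hβ0 h1β.le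
  have hfrac1 : β / (1 - β) ≤ 1 := by
    rw [div_le_one h1β]
    linarith
  have hA3 : CH * β / (1 - β) ≤ max CH 0 := by
    rw [mul_div_assoc]
    calc CH * (β / (1 - β)) ≤ max CH 0 * (β / (1 - β)) :=
          mul_le_mul_of_nonneg_right (le_max_left _ _) hfrac0
      _ ≤ max CH 0 * 1 := mul_le_mul_of_nonneg_left hfrac1 hCH'0
      _ = max CH 0 := mul_one _
  have hA3' : (Real.log M + 1 + CH * β / (1 - β)) * L ≤ (Real.log M + 1 + max CH 0) * L :=
    mul_le_mul_of_nonneg_right (by linarith) hL0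
  -- (3) `c₀ K₂' L ≤ K₂' L`
  have hA4 : c₀ * max K₂ 0 * L ≤ max K₂ 0 * L := by
    have h : c₀ * max K₂ 0 ≤ max K₂ 0 := mul_le_of_le_one_left hK₂'0 hc₀1
    exact mul_le_mul_of_nonneg_right h hL0
  -- (4) the budget
  have hA5 : (Real.log M + 1 + max CH 0) * L + max K₂ 0 * L ≤
      (Real.log M + Real.log (1 / c₀) - C) * L := by
    have h : Real.log M + 1 + max CH 0 + max K₂ 0 ≤ Real.log M + Real.log (1 / c₀) - C := by
      linarith
    have := mul_le_mul_of_nonneg_right h hL0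
    linarith
  linarith [hHM, hA1, hA3', hA4, hA5]

/-- **The analytic reduction** (the picked line's `analyticReduction`, re-assembled here from the
LANDED theorems `stub_arch`, `stub_autocorrelation`, `stub_polar`, `stub_prime` of
`…Theorems.WeilCombSubcritical`; glue copied from the lead's rev-L2 skeleton with credit): for a Weil
test `φ` supported in `[-1,1]`, `0 < ε`, `M ≥ 1`, `8εM ≤ 1`,
`Re Q(g) ≥ ε⁻¹‖φ‖₂²·[(log(1/ε) − C)‖a‖² − ⟨S_M a,a⟩ − ε·archShadow(a)]` with an ABSOLUTE `C`
(`Q(g) = W(g ⋆ g̃) = polar − prime + arch`, by definition). -/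
theorem analyticReduction :
    ∃ C : ℝ, ∀ φ : ℝ → ℂ, IsWeilTest φ → tsupport φ ⊆ Set.Icc (-1) 1 →
      ∀ ε : ℝ, 0 < ε → ∀ (M : ℕ) (a : ℕ → ℂ), 1 ≤ M → 8 * ε * M ≤ 1 →
        ε⁻¹ * weilNorm2Sq φ *
            ((Real.log (1 / ε) - C) * (∑ m ∈ Finset.Icc 1 M, ‖a m‖ ^ 2) -
              2 * (∑ m ∈ Finset.Icc 1 M, ∑ n ∈ Finset.Icc 1 (M / m),
                ((ArithmeticFunction.vonMangoldt n : ℝ) : ℂ) / (Real.sqrt n : ℂ) * a (n * m) *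
                  conj (a m)).re -
              ε * (5 * (∑ m ∈ Finset.Icc 1 M, ‖a m‖ / Real.sqrt m) *
                    (∑ m ∈ Finset.Icc 1 M, ‖a m‖ * Real.sqrt m) +
                  2 * (∑ m ∈ Finset.Icc 1 M, ∑ m' ∈ (Finset.Icc 1 M).erase m,
                    ‖a m‖ * ‖a m'‖ / |Real.log m - Real.log m'|) +
                  2 * (∑ m ∈ Finset.Icc 1 M, ‖a m‖) ^ 2)) ≤
          (weilQuadratic (fun x : ℝ => ∑ m ∈ Finset.Icc 1 M,
            a m * ((ε : ℂ)⁻¹ * φ ((x - Real.log (m : ℝ)) / ε)))).re := by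
  obtain ⟨C, hC⟩ := stub_arch stub_autocorrelation
  refine ⟨C, fun φ hφ hsupp ε hε M a hM h8 => ?_⟩
  have hMr : (1 : ℝ) ≤ (M : ℝ) := by exact_mod_cast hM
  have hε8 : ε ≤ 1 / 8 := by nlinarith
  have hP := stub_polar φ hφ hsupp ε hε hε8 M a
  have hPr := stub_prime stub_autocorrelation φ hφ hsupp ε hε M a hM h8
  have hA := hC φ hφ hsupp ε hε M a hM h8
  -- names for the real atoms
  set N : ℝ := weilNorm2Sq φ with hN
  set H : ℝ := 2 * (∑ m ∈ Finset.Icc 1 M, ∑ n ∈ Finset.Icc 1 (M / m),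
      ((ArithmeticFunction.vonMangoldt n : ℝ) : ℂ) / (Real.sqrt n : ℂ) * a (n * m) *
        conj (a m)).re with hH
  set L : ℝ := ∑ m ∈ Finset.Icc 1 M, ‖a m‖ ^ 2 with hL
  set Am : ℝ := ∑ m ∈ Finset.Icc 1 M, ‖a m‖ / Real.sqrt m with hAm
  set Ap : ℝ := ∑ m ∈ Finset.Icc 1 M, ‖a m‖ * Real.sqrt m with hAp
  set B : ℝ := ∑ m ∈ Finset.Icc 1 M, ∑ m' ∈ (Finset.Icc 1 M).erase m,
      ‖a m‖ * ‖a m'‖ / |Real.log m - Real.log m'| with hB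
  set A1 : ℝ := ∑ m ∈ Finset.Icc 1 M, ‖a m‖ with hA1
  set k : ℝ → ℂ := weilConv (fun x : ℝ => ∑ m ∈ Finset.Icc 1 M,
      a m * ((ε : ℂ)⁻¹ * φ ((x - Real.log (m : ℝ)) / ε)))
    (weilReflect (fun x : ℝ => ∑ m ∈ Finset.Icc 1 M,
      a m * ((ε : ℂ)⁻¹ * φ ((x - Real.log (m : ℝ)) / ε)))) with hk
  have hQ : (weilQuadratic (fun x : ℝ => ∑ m ∈ Finset.Icc 1 M,
      a m * ((ε : ℂ)⁻¹ * φ ((x - Real.log (m : ℝ)) / ε)))).re =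
      (weilPolarTerm k).re - (weilPrimeTerm k).re + (weilArchTerm k).re := by
    simp only [weilQuadratic, weilFunctional, hk, Complex.add_re, Complex.sub_re]
  rw [hQ, hPr, Complex.ofReal_re]
  have e : ε⁻¹ * N * ((Real.log (1 / ε) - C) * L - H - ε * (5 * Am * Ap + 2 * B + 2 * A1 ^ 2)) =
      ε⁻¹ * N * ((Real.log (1 / ε) - C) * L) - ε⁻¹ * N * H -
        (5 * N * Am * Ap + 2 * N * (B + A1 ^ 2)) := by
    field_simp
    ring
  rw [e]
  linarith [hP, hA]

/-- **`CombSubcritical` from the stubs.**  The arithmetic core (`stub_hardy`, `stub_shadow` ⇒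
`core_of_hardy_shadow`) and the analytic reduction (landed) are glued by bookkeeping: given `C` from
the reduction take `c₀ ≤ 1/8` from the core at the same `C`; for `M ≥ 1`, `εM ≤ c₀` gives `8εM ≤ 1`,
`ε ≤ c₀/M` and `log(1/ε) ≥ log M + log(1/c₀)`, so the bracket of the reduction dominates
`(log M + log(1/c₀) − C)‖a‖² − ⟨S_M a,a⟩ − (c₀/M)·archShadow(a) ≥ 0`; `M = 0` is `Q(0) = 0`
(`weilQuadratic_zero`).  (Glue as in the lead's rev-L2 skeleton of the picked line.) -/
theorem CombSubcritical_of :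
    Summit.RiemannHypothesis.RiemannHypothesis.Theses.WeilComb.CombSubcritical := by
  have hcore := core_of_hardy_shadow stub_hardy stub_shadow
  obtain ⟨C, hC⟩ := analyticReduction
  obtain ⟨c₀, hc₀, hc₀8, hK⟩ := hcore C
  refine ⟨c₀, hc₀, ?_⟩
  intro φ hφ hsupp ε hε M a hεM
  rcases Nat.eq_zero_or_pos M with hM0 | hMpos
  · -- `M = 0`: the comb is the zero function and `Q(0) = 0`
    subst hM0
    have h0 : (fun x : ℝ => ∑ m ∈ Finset.Icc 1 0,
        a m * ((ε : ℂ)⁻¹ * φ ((x - Real.log (m : ℝ)) / ε))) = 0 := by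
      funext x
      simp
    rw [h0, weilQuadratic_zero]
    simp
  · have hM1 : 1 ≤ M := hMpos
    have hMr : (1 : ℝ) ≤ (M : ℝ) := by exact_mod_cast hM1
    have hMpos' : (0 : ℝ) < (M : ℝ) := by linarith
    -- uses `ε·M ≤ c₀` (i): `8εM ≤ 8c₀ ≤ 1`
    have h8 : 8 * ε * M ≤ 1 := by nlinarith [hεM, hc₀8]
    have hR := hC φ hφ hsupp ε hε M a hM1 h8
    have hKM := hK M a hM1
    -- uses `ε·M ≤ c₀` (ii): `ε ≤ c₀ / M` pays the archimedean shadow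
    have hεle : ε ≤ c₀ / M := by
      rw [le_div_iff₀ hMpos']
      exact hεM
    -- uses `ε·M ≤ c₀` (iii): the budget `log(1/ε) ≥ log M + log(1/c₀)`
    have hlog : Real.log M + Real.log (1 / c₀) ≤ Real.log (1 / ε) := by
      have e1 : Real.log M + Real.log (1 / c₀) = Real.log (M / c₀) := by
        rw [Real.log_div hMpos'.ne' hc₀.ne', one_div, Real.log_inv]
        ring
      rw [e1]
      apply Real.log_le_log (by positivity)
      rw [div_le_div_iff₀ hc₀ hε]
      nlinarith [hεM]
    -- names for the real atoms
    set H : ℝ := 2 * (∑ m ∈ Finset.Icc 1 M, ∑ n ∈ Finset.Icc 1 (M / m),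
          ((ArithmeticFunction.vonMangoldt n : ℝ) : ℂ) / (Real.sqrt n : ℂ) * a (n * m) *
            conj (a m)).re with hH
    set L : ℝ := ∑ m ∈ Finset.Icc 1 M, ‖a m‖ ^ 2 with hL
    set S : ℝ := 5 * (∑ m ∈ Finset.Icc 1 M, ‖a m‖ / Real.sqrt m) *
              (∑ m ∈ Finset.Icc 1 M, ‖a m‖ * Real.sqrt m) +
            2 * (∑ m ∈ Finset.Icc 1 M, ∑ m' ∈ (Finset.Icc 1 M).erase m,
              ‖a m‖ * ‖a m'‖ / |Real.log m - Real.log m'|) +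
            2 * (∑ m ∈ Finset.Icc 1 M, ‖a m‖) ^ 2 with hS
    have hS0 : 0 ≤ S := by
      have h1 : 0 ≤ ∑ m ∈ Finset.Icc 1 M, ‖a m‖ / Real.sqrt m :=
        Finset.sum_nonneg fun _ _ => by positivity
      have h2 : 0 ≤ ∑ m ∈ Finset.Icc 1 M, ‖a m‖ * Real.sqrt m :=
        Finset.sum_nonneg fun _ _ => by positivity
      have h3 : 0 ≤ ∑ m ∈ Finset.Icc 1 M, ∑ m' ∈ (Finset.Icc 1 M).erase m,
          ‖a m‖ * ‖a m'‖ / |Real.log m - Real.log m'| :=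
        Finset.sum_nonneg fun _ _ => Finset.sum_nonneg fun _ _ => by positivity
      have h4 : 0 ≤ (∑ m ∈ Finset.Icc 1 M, ‖a m‖) ^ 2 := sq_nonneg _
      rw [hS]
      nlinarith [mul_nonneg h1 h2]
    have hL0 : 0 ≤ L := Finset.sum_nonneg fun _ _ => by positivity
    have hX : 0 ≤ (Real.log (1 / ε) - C) * L - H - ε * S := by
      have h1 : ε * S ≤ c₀ / M * S := mul_le_mul_of_nonneg_right hεle hS0
      have h2 : (Real.log M + Real.log (1 / c₀) - C) * L ≤ (Real.log (1 / ε) - C) * L :=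
        mul_le_mul_of_nonneg_right (by linarith) hL0
      linarith [hKM, h1, h2]
    have hpref : 0 ≤ ε⁻¹ * weilNorm2Sq φ :=
      mul_nonneg (inv_nonneg.2 hε.le) (weilNorm2Sq_nonneg φ)
    exact le_trans (mul_nonneg hpref hX) hR

end Summit.RiemannHypothesis.RiemannHypothesis.Cruxes.CombSubcritical.TiltedGaugeHardy

end

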